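import Summits.ResolutionOfSingularities.ResolutionOfSingularities.Theorems.HilbertSamuelEliminationSigmaMaxModificationsCorridor3WLadderIsoKernelCPSliceEmbeddings
import HarnessLib

/-!
# [OURS · L1 W4.2] THE ISO-KERNEL SLICE IN COSSART–PILTANT'S FRAME — the origin hypothesis made valuation-free: «the origin stalk is a
# LOCAL RING OF the germ `R[x]`» implies `θ₀(𝒪) = (R[x])_{𝔪_O ∩ R[x]}` for EVERY dominating valuation ring `O`

Crux chain w42 (`SigmaMaxModifications`, stmt-ResolutionOfSingularities-18506; conjunct `SigmaMaxModificationsCorridor3`, stmt-…-19249),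
line `w_ladder`, registered stubs `stub_isoInsepTower` / `stub_isoSepRecurrent`. Lead res-L1-w42-lead-1 (gen 5). Helper file
`--supports stmt-ResolutionOfSingularities-19249`; kernel only (no definition, no new named fact; CONDITIONAL on `CossartPiltant2019LocalPermissible`).

WHAT IS PROVED. (`locAtCentre_eq_of_isLocalRingOf`) If a subring `S ⊆ L` contains `B` and every element of `S` is a fraction `y/z` with
`y, z ∈ B` and `z⁻¹ ∈ S` («`S` is a local ring of `B`», Cutkosky §2.1), then for EVERY valuation ring `O` dominating `S`,
`S = locAtCentre B O = (B)_{𝔪_O ∩ B}`. Hence (`false_of_isIsoPointTower_pCyclic_of_CP'`) the intrinsic slice `false_of_isIsoPointTower_pCyclic_of_CP`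
(p556774) with its `∀ O`-hypothesis `horigin` replaced by the valuation-free «`θ₀(𝒪_{X_0,x_0})` is a local ring of `R[x]`»: Cossart–Piltant's
frame + an isolated E3 point tower (integral stages, bottom stage of finite type over a field, `ν ≠ Φ^{(N)}`, `dim 𝒪_{X_0,x_0} ≤ N`) whose origin
stalk embeds into `L` as a local ring of the germ `R[x]` containing `R` dominated ⇒ `False`, modulo the printed CP 2019 Thm. 1.5.

HONEST FRAMING. OURS bookkeeping; nothing here is a statement of H. Hironaka's manuscript [Hironaka2017] nor a new claim about [CossartPiltant2019].
AI-written; AI review is weaker than expert review.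

References: S. D. Cutkosky (2014) §2.1 (local rings of `K`, domination) [Cutkosky2014]; V. Cossart, O. Piltant, J. Algebra 529 (2019), Thm. 1.5
[CossartPiltant2019].
-/

noncomputable section

set_option linter.dupNamespace false

open Polynomial IsLocalRing AlgebraicGeometry CategoryTheory
open Literature.AlgebraicGeometry.Resolution Literature.AlgebraicGeometry.CossartJannsenSaito2020 Literature.RingTheory.HilbertSamuel
open Summit.ResolutionOfSingularities.ResolutionOfSingularities.Cruxes.SigmaMaxModifications.IdeasL1Idea2R4 (IsIsoPointTower)

namespace Summit.ResolutionOfSingularities.ResolutionOfSingularities.Cruxes.SigmaMaxModifications.IdeasL1C5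

universe u

variable {L : Type u} [Field L]

/-- **A local ring of `B` is `(B)_{𝔪_O ∩ B}` for every dominating valuation ring `O`.** If `B ≤ S ⊆ L` and every element of `S` is `y / z` with
`y, z ∈ B`, `z⁻¹ ∈ S`, then `S = locAtCentre B O` whenever `O` dominates `S` (`z, z⁻¹ ∈ O` forces value `1`; elements of `B` of value `1` are
invertible in `S` by domination). [cite: Cutkosky2014, §2.1] -/
theorem locAtCentre_eq_of_isLocalRingOf {B S : Subring L} (hBS : B ≤ S)
    (hfrac : ∀ w ∈ S, ∃ y ∈ B, ∃ z ∈ B, z⁻¹ ∈ S ∧ w = y / z)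
    (O : ValuationSubring L) (hdom : SubringDominates S O.toSubring) : S = locAtCentre B O := by
  have hSO : S ≤ O.toSubring := hdom.1
  apply le_antisymm
  · intro w hw
    obtain ⟨y, hy, z, hz, hzinv, rfl⟩ := hfrac w hw
    by_cases hz0 : z = 0
    · subst hz0
      exact ⟨0, B.zero_mem, 1, B.one_mem, by simp, by simp⟩
    · -- `z` and `z⁻¹` lie in `O`: `v(z) = 1`
      have h1 : O.valuation z ≤ 1 := (O.valuation_le_one_iff _).mpr (hSO (hBS hz))
      have h2 : O.valuation z⁻¹ ≤ 1 := (O.valuation_le_one_iff _).mpr (hSO hzinv)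
      rw [map_inv₀, inv_le_one₀ ((Valuation.pos_iff _).mpr hz0)] at h2
      exact ⟨y, hy, z, hz, le_antisymm h1 h2, rfl⟩
  · rintro _ ⟨y, hy, z, hz, hvz, rfl⟩
    -- `z ∈ B ≤ S` has value `1`, hence `z⁻¹ ∈ S` by domination
    have hzinvO : z⁻¹ ∈ O.toSubring := by
      change z⁻¹ ∈ O
      rw [← O.valuation_le_one_iff, map_inv₀, hvz, inv_one]
    have hzinv : z⁻¹ ∈ S := hdom.2 z (hBS hz) hzinvO
    rw [div_eq_mul_inv]
    exact S.mul_mem (hBS hy) hzinv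

/-- **THE ISO-KERNEL SLICE IN COSSART–PILTANT'S FRAME — INTRINSIC, VALUATION-FREE ORIGIN (modulo print).** As `false_of_isIsoPointTower_pCyclic_of_CP`
(p556774), with the origin identified by: `R ≤ θ₀(𝒪_{X_0,x_0})` dominated, `R[x] ≤ θ₀(𝒪)`, and every element of `θ₀(𝒪)` a fraction `y/z`, `y, z ∈ R[x]`,
`z⁻¹ ∈ θ₀(𝒪)` — i.e. the origin stalk IS a local ring of Cossart–Piltant's germ `𝒳 = Spec R[x]`. CONDITIONAL on
`CossartPiltant2019LocalPermissible`. [cite: CossartPiltant2019, Thm. 1.5 (arXiv v1: Thm. 1.4)] [cite: Cutkosky2014, §2.1] -/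
theorem false_of_isIsoPointTower_pCyclic_of_CP' (hCP : CossartPiltant2019LocalPermissible.{u})
    (p : ℕ) (hp : p.Prime) (R : Subring L) [IsRegularLocalRing R]
    (hexc : IsExcellentRing R) (hdim : ringKrullDim R = 3) (hchar : CharP (ResidueField R) p)
    (h : R[X]) (x : L) (hmon : h.Monic) (hdeg : h.natDegree = p) (hx : aeval x h = 0)
    (hmin : ∀ g : R[X], g.natDegree < p → aeval x g = 0 → g = 0)
    (hgen : ∀ z : L, ∃ (g : R[X]) (s : R), s ≠ 0 ∧ z * s = aeval x g)
    (hcase : (CharP L p ∧ ∀ i, 0 < i → i < p → h.coeff i = 0) ∨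
      (Nat.card (L ≃ₐ[R] L) = p ∧
        ∀ σ : L ≃ₐ[R] L, ∀ y ∈ Algebra.adjoin R ({x} : Set L), σ y ∈ Algebra.adjoin R ({x} : Set L)))
    {N : ℕ} {ν : ℕ → ℕ} {T : BlowupTower.{u}} {pt : ∀ n, T.X n} (hT : IsIsoPointTower N ν T pt)
    (hint : ∀ n, IsIntegral (T.X n))
    {k : Type u} [Field k] (g : T.X 0 ⟶ Spec (.of k)) [LocallyOfFiniteType g]
    (hνΦ : ν ≠ iterPSum N Phi) (hd0 : ringKrullDim ((T.X 0).presheaf.stalk (pt 0)) ≤ N)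
    (θ₀ : (T.X 0).presheaf.stalk (pt 0) →+* L) (h₀ : Function.Injective θ₀)
    (hR0 : R ≤ θ₀.range) (hRdom : SubringDominates R θ₀.range)
    (hB : (Algebra.adjoin R ({x} : Set L)).toSubring ≤ θ₀.range)
    (hfrac : ∀ w ∈ θ₀.range, ∃ y ∈ (Algebra.adjoin R ({x} : Set L)).toSubring, ∃ z ∈ (Algebra.adjoin R ({x} : Set L)).toSubring,
      z⁻¹ ∈ θ₀.range ∧ w = y / z) :
    False :=
  false_of_isIsoPointTower_pCyclic_of_CP hCP p hp R hexc hdim hchar h x hmon hdeg hx hmin hgen hcase hT hint g hνΦ hd0 θ₀ h₀ hR0 hRdom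
    fun O hdom => locAtCentre_eq_of_isLocalRingOf hB hfrac O hdom

end Summit.ResolutionOfSingularities.ResolutionOfSingularities.Cruxes.SigmaMaxModifications.IdeasL1C5

end
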